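import Mathlib
import Summits.Ventures.PercRepro2.TB14CutGenB
import Summits.Ventures.PercRepro2.TB14CutTransfer

/-!
# The block reduction of typed BHK 1.4: (TB14) on all graphs from (TB14) on graphs without a cut vertex
(blind cell PercRepro2, mine-c g15, 2026-08-25; `proofs/MINEC-TB14BLOCK.md` Corollary, `conjectures/MINE-C.md` §24)

A PROPER CUT of a graph `ends : E → Sym2 V` is a cut vertex `c` with an edge on each side
(`CutV.IsCut ends c VA VB EA EB`, `EA`, `EB` nonempty).  **`tb14_allFree_of_noProperCut`**: if typed
BHK 1.4 at the all-free profile holds on every graph WITHOUT a proper cut (the 2-connected graphs,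
with isolated vertices), then it holds on every finite graph — by strong induction on the number of
edges through `tb14_of_cut'` (the roots separated by the cut) and `tb14_of_pendant_cut'` (both
roots on one side), the side instances being the all-free instances of the sides' own graphs
(`pairCount_side_eq_subtype`), which have fewer edges.  So the open part of row 2′TB is exactly
its 2-connected all-free instances.  Own work; standard axioms.
-/

namespace Summit.Ventures.PercRepro2

namespace TB14Cut

open CovForm A3InactiveTyped CutV

section Isolated

variable {V : Type*} {E : Type*} {ends : E → Sym2 V} {x : V} {VA VB : Set V} {EA EB : Set E}

/-- `within` is monotone in the vertex set. -/
lemma within_mono {S T : Set V} (hST : S ⊆ T) : within ends S ⊆ within ends T := by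
  rintro e ⟨a, ha, b, hb, he⟩
  exact ⟨a, hST ha, b, hST hb, he⟩

/-- The isolated vertices (off both sides and the cut vertex) may be added to the side `A`. -/
lemma isCut_isolated (h : IsCut ends x VA VB EA EB) :
    IsCut ends x (VA ∪ (VA ∪ VB ∪ {x})ᶜ) VB EA EB where
  disj := by
    rw [Set.disjoint_union_left]
    refine ⟨h.disj, Set.disjoint_left.2 fun v hv hvB => ?_⟩
    exact hv (Or.inl (Or.inr hvB))
  x_notA := fun hx => hx.elim h.x_notA fun hI => hI (Or.inr rfl)
  x_notB := h.x_notB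
  EA_sub := fun e he => within_mono (Set.union_subset_union_left _ Set.subset_union_left) (h.EA_sub he)
  EB_sub := h.EB_sub
  cover := h.cover
  Edisj := h.Edisj

/-- After adding the isolated vertices, every vertex lies on a closed side. -/
lemma isolated_cover (v : V) :
    v ∈ (VA ∪ (VA ∪ VB ∪ {x})ᶜ) ∪ {x} ∨ v ∈ VB ∪ {x} := by
  by_cases hv : v ∈ VA ∪ VB ∪ {x}
  · rcases hv with (hv | hv) | hv
    · exact Or.inl (Or.inl (Or.inl hv))
    · exact Or.inr (Or.inl hv)
    · exact Or.inl (Or.inr hv)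
  · exact Or.inl (Or.inl (Or.inr hv))

end Isolated

section Induction

variable (R : Type*) [Field R] [LinearOrder R] [IsStrictOrderedRing R]

/-- The induction on the number of edges. -/
theorem tb14_allFree_aux
    (H : ∀ (V E : Type) [Fintype E] [DecidableEq E] (ends : E → Sym2 V),
      (¬ ∃ (c : V) (VA VB : Set V) (EA EB : Set E),
        IsCut ends c VA VB EA EB ∧ EA.Nonempty ∧ EB.Nonempty) →
      ∀ a₁ a₂ b o : V,
        pairCount Finset.univ (fun _ => false) (sameBO ends a₁ a₂ b o : Config E → Config E → R) ≤
          pairCount Finset.univ (fun _ => false) (crossBO ends a₁ a₂ b o))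
    (n : ℕ) :
    ∀ (V E : Type) [Fintype E] [DecidableEq E] (ends : E → Sym2 V), Fintype.card E = n →
      ∀ a₁ a₂ b o : V,
        pairCount Finset.univ (fun _ => false) (sameBO ends a₁ a₂ b o : Config E → Config E → R) ≤
          pairCount Finset.univ (fun _ => false) (crossBO ends a₁ a₂ b o) := by
  induction n using Nat.strong_induction_on with
  | _ n ih =>
    intro V E _ _ ends hn a₁ a₂ b o
    by_cases hcut : ∃ (c : V) (VA VB : Set V) (EA EB : Set E),
        IsCut ends c VA VB EA EB ∧ EA.Nonempty ∧ EB.Nonempty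
    · obtain ⟨c, VA, VB, EA, EB, h, hEA, hEB⟩ := hcut
      classical
      have h' := isCut_isolated h
      -- the side instances, from the induction hypothesis
      have hA : ∀ a₁' a₂' b' o' : V,
          pairCount (sideFree EA Finset.univ) (restrict EA (fun _ => false))
              (sameBO ends a₁' a₂' b' o' : Config E → Config E → R) ≤
            pairCount (sideFree EA Finset.univ) (restrict EA (fun _ => false))
              (crossBO ends a₁' a₂' b' o') := by
        intro a₁' a₂' b' o'
        rw [pairCount_side_eq_subtype, pairCount_side_eq_subtype]
        simp only [sameBO_extend, crossBO_extend]
        obtain ⟨e, he⟩ := hEB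
        have hlt : Fintype.card {e // e ∈ EA} < n := by
          rw [← hn]
          exact Fintype.card_subtype_lt (fun heA => Set.disjoint_left.1 h.Edisj heA he)
        exact ih _ hlt V {e // e ∈ EA} (sideEnds EA ends) rfl a₁' a₂' b' o'
      have hB : ∀ a₁' a₂' b' o' : V,
          pairCount (sideFree EB Finset.univ) (restrict EB (fun _ => false))
              (sameBO ends a₁' a₂' b' o' : Config E → Config E → R) ≤
            pairCount (sideFree EB Finset.univ) (restrict EB (fun _ => false))
              (crossBO ends a₁' a₂' b' o') := by
        intro a₁' a₂' b' o'
        rw [pairCount_side_eq_subtype, pairCount_side_eq_subtype]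
        simp only [sameBO_extend, crossBO_extend]
        obtain ⟨e, he⟩ := hEA
        have hlt : Fintype.card {e // e ∈ EB} < n := by
          rw [← hn]
          exact Fintype.card_subtype_lt (fun heB => Set.disjoint_left.1 h.Edisj he heB)
        exact ih _ hlt V {e // e ∈ EB} (sideEnds EB ends) rfl a₁' a₂' b' o'
      have hcov : ∀ v : V, v ∈ (VA ∪ (VA ∪ VB ∪ {c})ᶜ) ∪ {c} ∨ v ∈ VB ∪ {c} :=
        fun v => isolated_cover v
      rcases hcov a₁ with ha₁ | ha₁ <;> rcases hcov a₂ with ha₂ | ha₂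
      · exact tb14_of_pendant_cut' h' ha₁ ha₂ (hcov b) (hcov o) _ _ (hA _ _ _ _) (hA _ _ _ _)
          (hA _ _ _ _)
      · exact tb14_of_cut' h' ha₁ ha₂ (hcov b) (hcov o) _ _ (hA _ _ _ _) (hB _ _ _ _)
      · exact tb14_of_cut' h'.symm ha₁ ha₂ (hcov b).symm (hcov o).symm _ _ (hB _ _ _ _)
          (hA _ _ _ _)
      · exact tb14_of_pendant_cut' h'.symm ha₁ ha₂ (hcov b).symm (hcov o).symm _ _ (hB _ _ _ _)
          (hB _ _ _ _) (hB _ _ _ _)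
    · exact H V E ends hcut a₁ a₂ b o

/-- **The block reduction of typed BHK 1.4** (THEOREM): if typed BHK 1.4 at the all-free profile
holds on every finite graph without a proper cut (a cut vertex with an edge on each side — the
2-connected graphs, isolated vertices allowed), then it holds on every finite graph. -/
theorem tb14_allFree_of_noProperCut
    (H : ∀ (V E : Type) [Fintype E] [DecidableEq E] (ends : E → Sym2 V),
      (¬ ∃ (c : V) (VA VB : Set V) (EA EB : Set E),
        IsCut ends c VA VB EA EB ∧ EA.Nonempty ∧ EB.Nonempty) →
      ∀ a₁ a₂ b o : V,
        pairCount Finset.univ (fun _ => false) (sameBO ends a₁ a₂ b o : Config E → Config E → R) ≤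
          pairCount Finset.univ (fun _ => false) (crossBO ends a₁ a₂ b o)) :
    ∀ (V E : Type) [Fintype E] [DecidableEq E] (ends : E → Sym2 V) (a₁ a₂ b o : V),
      pairCount Finset.univ (fun _ => false) (sameBO ends a₁ a₂ b o : Config E → Config E → R) ≤
        pairCount Finset.univ (fun _ => false) (crossBO ends a₁ a₂ b o) :=
  fun V E _ _ ends a₁ a₂ b o => tb14_allFree_aux R H (Fintype.card E) V E ends rfl a₁ a₂ b o

end Induction

end TB14Cut

end Summit.Ventures.PercRepro2
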